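import Literature.NumberTheory.EllipticCurves.BurungaleSkinnerTianWan2024.SupersingularTwistPPartOPEN
import Literature.NumberTheory.EllipticCurves.Rank1Residual.Predicates
import Summits.BirchSwinnertonDyer.BirchSwinnertonDyer.Theorems.SmallImageMuTransferMuZeroCMKatzFrame
import Summits.BirchSwinnertonDyer.Rank1Residual.X11b.TransvectionAbsIrreducible
import Literature.NumberTheory.QuadraticFields.ImaginaryQuadraticPrescribedSplitting
import Literature.NumberTheory.NumberFields.ImaginaryQuadraticEmbedding
import Literature.NumberTheory.Automorphic.CDTTheorem722SerreProofs
import Literature.NumberTheory.Automorphic.CaraianiNewtonResidualImageModularity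
import Literature.NumberTheory.Automorphic.QuadraticCharacterTwist
import Literature.NumberTheory.FaltingsSerre.CertificateConjTransfer
import Literature.NumberTheory.EllipticCurves.TateModuleGaloisTransportProofs
import Literature.NumberTheory.EllipticCurves.NonEisensteinPrimeOfSurjective
import Literature.NumberTheory.EllipticCurves.ModularParametrizationBCDTProofs
import Literature.NumberTheory.EllipticCurves.GlobalMinimalModelProofs
import Literature.NumberTheory.EllipticCurves.QuadraticTwist
import Mathlib.NumberTheory.PrimesCongruentOne
import HarnessLib

/-!
# K1 `TwistPairGreenbergProductDivisibility` (stmt-BirchSwinnertonDyer-20249), line `birth`, registered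
# stub `stub_frameData`: the ARITHMETIC FRAME of K1 exists (route SignedBaseChange; `--supports` 20249)

The crux K1 of route `SignedBaseChange` has the shape `∃ (frame data), (18 side conditions) ∧ ∀ (Katz /
Greenberg frames), product divisibility`. The reshaped BC3 skeleton of line `birth` (lead prover sbc-p1,
skeleton 4a5cf194) splits it into `stub_frameData` (the `∃` half with the 18 conditions) and
`stub_productDivisibility` (the `∀` half for every admissible datum). THIS FILE proves `stub_frameData`
VERBATIM — the route rationale's "choice of `(K, d, F)` (Chebotarev bookkeeping) is provable-now glue inside
K1's `∃`" — from tree theorems only (no named fact is consumed beyond the stub's own modularity hypothesis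
`nonempty_modularParametrizationData`):

* §1 `exists_field`: an imaginary quadratic `K` with PRIME discriminant `d_K = −q`, `q` beyond any bound, in
  which `p` splits (Dirichlet + decomposition law: `Quadratic.exists_imaginaryQuadratic_forall_split`); so
  `(N, d_K) = 1` (`isCoprime_of_lt`).
* §2 `exists_pair_of_ncard_primesOver_eq_two`: two primes above `p` ⟹ height-one primes `v ≠ v̄ ∋ p`.
* §3 `exists_isTopGeneratorPair_isCyclotomic_isAnticyclotomic`: for `p` odd, the cyclotomic line `κ₁`
  (restricted from `ℚ`, fixed under conjugation; `MuZeroCMKatzFrame.exists_isCyclotomic_isTopGenerator_normalised`)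
  and the anticyclotomic line `κ₂` (`ZpExtension.exists_isAnticyclotomic_holds`) are jointly onto `ℤ_p²`
  (`IwasawaTwoVariable.exists_apply_eq_of_isAnticyclotomic_of_fixed`), whence an ADAPTED generator pair.
* §4 `exists_iota`: the embedding datum `ι : ℚ̄_p ≃ ℂ` inducing `v` (`MuZeroCMKatzFrame.exists_ringEquiv_mem_iff_norm_lt_one`).
* §5 `irrK_framed_of_surj`: (sur) over `ℚ`, `p ≠ 2` ⟹ EVERY `𝔽_p`-framing of `E[p]|_{Γ_K}` is absolutely
  irreducible: a framing over `ℚ` takes the value `(1 1; 0 1)` (surjectivity), so its restriction to the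
  index-2 subgroup `Γ_K` is absolutely irreducible (`X11b.Transvection.isAbsolutelyIrreducible_comp_of_index_two_of_transvection`);
  the restriction IS a framing of `E_K[p]` (`isTorsionGaloisRep_baseChange_comp`, transport along
  `exists_addEquiv_geomPoints_baseChange`), any other framing is conjugate (`IsTorsionGaloisRep.exists_conj`),
  and absolute irreducibility is conjugation-invariant (`IsAbsIrreducible.of_conj`).
* §6 `stub_frameData`: assembly — the newform `f` of `W` (BCDT datum), the twist `d = ℓ` a prime `≡ 1 (mod 4)`
  beyond `N + p + q` (`Nat.exists_prime_gt_modEq_one`; ramified in `ℚ(√ℓ)` only at `ℓ ∤ pN d_K`), a globally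
  minimal model `W'` of `W^{(ℓ)}` (`hasGlobalMinimalModel_rat_holds`) and its newform `f'`.

Proves a registered stub by name and signature; closes nothing by itself (`stub_productDivisibility` is the
crux's open content). File with `ledger propose --target
Summits/BirchSwinnertonDyer/BirchSwinnertonDyer/Theorems/SignedBaseChangeTwistPairGreenbergProductDivisibilityStubFrameData.lean
--supports stmt-BirchSwinnertonDyer-20249`.
-/

-- D-0017: single-problem summit, the namespace repeats the problem name by design.
set_option linter.dupNamespace false
set_option autoImplicit false

noncomputable section

open scoped Classical MatrixGroups Matrix
open NumberField IsDedekindDomain Field WeierstrassCurve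
open Literature.NumberTheory.EllipticCurves Literature.NumberTheory.GaloisRepresentations
  Literature.NumberTheory.EllipticCurves.ModularForms

namespace Summit.BirchSwinnertonDyer.BirchSwinnertonDyer.Theorems.SignedBaseChangeK1FrameData


/-! ## §1 The imaginary quadratic field -/

/-- **Field choice.** For a prime `p` and any bound `n` there is an imaginary quadratic field `K` of
prime discriminant `d_K = -q` with `q > n` in which `p` splits; in particular every non-zero integer
`N ≤ n` is coprime to `d_K`. (Dirichlet + decomposition law, via the tree's
`Quadratic.exists_imaginaryQuadratic_forall_split`.) -/
theorem exists_field (p : ℕ) [hp : Fact p.Prime] (n : ℕ) :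
    ∃ (K : Type) (_ : Field K) (_ : NumberField K) (q : ℕ),
      IsImaginaryQuadratic K ∧ q.Prime ∧ n < q ∧ NumberField.discr K = -q ∧
        ((Ideal.span {(p : ℤ)}).primesOver (𝓞 K)).ncard = 2 := by
  obtain ⟨K, _, _, q, h2, htc, hq, hnq, -, -, hdisc, hsplit, -⟩ :=
    Literature.NumberTheory.QuadraticFields.Quadratic.exists_imaginaryQuadratic_forall_split {p} n
  exact ⟨K, inferInstance, inferInstance, q, ⟨h2, htc⟩, hq, hnq, hdisc,
    hsplit p (Finset.mem_singleton_self p) hp.out⟩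

/-- A prime `q > N` with `N ≠ 0` does not divide `N`, so `N` is coprime to `-q`. -/
theorem isCoprime_of_lt {N q : ℕ} (hq : q.Prime) (hN : N ≠ 0) (hlt : N < q) :
    IsCoprime (N : ℤ) (-(q : ℤ)) := by
  rw [IsCoprime.neg_right_iff, Nat.isCoprime_iff_coprime, Nat.coprime_comm, hq.coprime_iff_not_dvd]
  exact fun h ↦ absurd (Nat.le_of_dvd (Nat.pos_of_ne_zero hN) h) (not_le.mpr hlt)

/-! ## §2 The two primes above a split `p` -/

/-- From "`p` splits in `K`" (two primes of `𝓞 K` above `p`): two DISTINCT height-one primes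
`v ≠ v̄` of `𝓞 K` containing `p`. -/
theorem exists_pair_of_ncard_primesOver_eq_two {K : Type} [Field K] [NumberField K] {p : ℕ}
    (hp : p.Prime) (h : ((Ideal.span {(p : ℤ)}).primesOver (𝓞 K)).ncard = 2) :
    ∃ v vbar : HeightOneSpectrum (𝓞 K),
      ((p : ℕ) : 𝓞 K) ∈ v.asIdeal ∧ ((p : ℕ) : 𝓞 K) ∈ vbar.asIdeal ∧ vbar ≠ v := by
  obtain ⟨P, Q, hPQ, hset⟩ := Set.ncard_eq_two.mp h
  have hP : P ∈ (Ideal.span {(p : ℤ)}).primesOver (𝓞 K) := by rw [hset]; exact Set.mem_insert _ _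
  have hQ : Q ∈ (Ideal.span {(p : ℤ)}).primesOver (𝓞 K) := by
    rw [hset]; exact Set.mem_insert_of_mem _ (Set.mem_singleton _)
  have hpne : Ideal.span {(p : ℤ)} ≠ ⊥ := by
    rw [Ne, Ideal.span_singleton_eq_bot]; exact_mod_cast hp.ne_zero
  have mk : ∀ R ∈ (Ideal.span {(p : ℤ)}).primesOver (𝓞 K),
      R.IsPrime ∧ R ≠ ⊥ ∧ ((p : ℕ) : 𝓞 K) ∈ R := by
    intro R hR
    haveI : R.IsPrime := hR.1
    haveI : R.LiesOver (Ideal.span {(p : ℤ)}) := hR.2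
    refine ⟨hR.1, Ideal.ne_bot_of_liesOver_of_ne_bot hpne R, ?_⟩
    have : (algebraMap ℤ (𝓞 K)) (p : ℤ) ∈ R := by
      rw [← Ideal.mem_comap, ← Ideal.under_def, ← Ideal.LiesOver.over (p := Ideal.span {(p : ℤ)})]
      exact Ideal.mem_span_singleton_self _
    simpa using this
  obtain ⟨hP1, hP2, hP3⟩ := mk P hP
  obtain ⟨hQ1, hQ2, hQ3⟩ := mk Q hQ
  exact ⟨⟨P, hP1, hP2⟩, ⟨Q, hQ1, hQ2⟩, hP3, hQ3, fun hc ↦ hPQ (congrArg HeightOneSpectrum.asIdeal hc).symm⟩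

/-! ## §3 The generator pair: `κ₁` cyclotomic, `κ₂` anticyclotomic -/

/-- **Adapted generator pair for (cyclotomic, anticyclotomic).** `K` imaginary quadratic, `p` odd:
there are `ℤ_p`-extensions `κ₁` (cyclotomic) and `κ₂` (anticyclotomic) of `K` and `γ₁, γ₂ ∈ Γ_K`
with `IsTopGeneratorPair κ₁ κ₂ γ₁ γ₂`: the restricted cyclotomic line is fixed under conjugation by
`Γ_ℚ` (`MuZeroCMKatzFrame.exists_isCyclotomic_isTopGenerator_normalised`), so `(κ₁, κ₂)` is jointly
onto `ℤ_p²` (`IwasawaTwoVariable.exists_apply_eq_of_isAnticyclotomic_of_fixed`); take preimages of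
`(1, 0)` and `(0, 1)`. -/
theorem exists_isTopGeneratorPair_isCyclotomic_isAnticyclotomic {K : Type} [Field K] [NumberField K]
    {p : ℕ} [Fact p.Prime] (hK : IsImaginaryQuadratic K) (hp2 : p ≠ 2) :
    ∃ (κ₁ κ₂ : ZpExtension K p) (γ₁ γ₂ : absoluteGaloisGroup K),
      ZpExtension.IsTopGeneratorPair κ₁ κ₂ γ₁ γ₂ ∧ κ₁.IsCyclotomic ∧ κ₂.IsAnticyclotomic := by
  obtain ⟨κ₁, -, hcyc, -, hfix, -⟩ :=
    MuZeroCMKatzFrame.exists_isCyclotomic_isTopGenerator_normalised hK hp2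
  haveI : IsTotallyComplex K := hK.2
  obtain ⟨κ₂, hκ₂⟩ := ZpExtension.exists_isAnticyclotomic_holds (K := K) (p := p) hK.1
    (fun w ↦ IsTotallyComplex.isComplex w)
  have honto := IwasawaTwoVariable.exists_apply_eq_of_isAnticyclotomic_of_fixed hK hp2 hκ₂ hfix
  obtain ⟨γ₁, h11, h12⟩ := honto 1 0
  obtain ⟨γ₂, h21, h22⟩ := honto 0 1
  refine ⟨κ₁, κ₂, γ₁, γ₂, ⟨?_, ?_, ?_, ?_⟩, hcyc, hκ₂⟩
  · change κ₁ γ₁ = Multiplicative.ofAdd 1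
    rw [← h11, ofAdd_toAdd]
  · rw [ZpExtension.mem_kerSubgroup]
    apply Multiplicative.toAdd.injective
    rw [toAdd_one]; exact h12
  · rw [ZpExtension.mem_kerSubgroup]
    apply Multiplicative.toAdd.injective
    rw [toAdd_one]; exact h21
  · change κ₂ γ₂ = Multiplicative.ofAdd 1
    rw [← h22, ofAdd_toAdd]

/-! ## §4 The embedding datum -/

/-- The embedding datum `ι : ℚ̄_p ≃ ℂ` inducing `v` on an imaginary quadratic field. -/
theorem exists_iota {K : Type} [Field K] [NumberField K] {p : ℕ} [Fact p.Prime]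
    (hK : IsImaginaryQuadratic K) (v : HeightOneSpectrum (𝓞 K)) (hv : ((p : ℕ) : 𝓞 K) ∈ v.asIdeal) :
    ∃ ι : PadicAlgCl p ≃+* ℂ,
      ∀ (w : InfinitePlace K) (k : 𝓞 K), k ∈ v.asIdeal ↔ ‖ι.symm (w.embedding (k : K))‖ < 1 := by
  haveI : IsTotallyComplex K := hK.2
  exact MuZeroCMKatzFrame.exists_ringEquiv_mem_iff_norm_lt_one
    (Literature.NumberTheory.NumberFields.ImaginaryQuadratic.card_infinitePlace hK.1) v hv


/-! ## §5 (sur) ⟹ every framing of `E[p]|_{Γ_K}` is absolutely irreducible -/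

section IrrK

variable (W : WeierstrassCurve ℚ) [W.IsElliptic] (p : ℕ) [Fact p.Prime]

omit [W.IsElliptic] in
/-- **Under (sur), the image of every framing `ρ̄` of `E[p]` over `ℚ` contains the transvection
`(1 1; 0 1)`**: some `σ ∈ Γ_ℚ` has `ρ̄(σ) ≠ 1` and `(ρ̄(σ) − 1)² = 0`. -/
theorem exists_transvection_of_surj (hsurj : W.HasSurjectiveModNGaloisRep (p : ℤ))
    {ρ : ModPGaloisRep ℚ (ZMod p) 2} (hρ : W.IsTorsionGaloisRep p ρ) :
    ∃ σ : absoluteGaloisGroup ℚ,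
      ((ρ σ : GL (Fin 2) (ZMod p)) : Matrix (Fin 2) (Fin 2) (ZMod p)) ≠ 1 ∧
        (((ρ σ : GL (Fin 2) (ZMod p)) : Matrix (Fin 2) (Fin 2) (ZMod p)) - 1) *
          (((ρ σ : GL (Fin 2) (ZMod p)) : Matrix (Fin 2) (Fin 2) (ZMod p)) - 1) = 0 := by
  obtain ⟨e, he⟩ := hρ
  -- the transvection as an element of `GL₂(𝔽_p)`
  let T : GL (Fin 2) (ZMod p) :=
    ⟨!![1, 1; 0, 1], !![1, -1; 0, 1],
      by ext i j; fin_cases i <;> fin_cases j <;> simp [Matrix.mul_apply, Fin.sum_univ_two],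
      by ext i j; fin_cases i <;> fin_cases j <;> simp [Matrix.mul_apply, Fin.sum_univ_two]⟩
  have hTval : (T : Matrix (Fin 2) (Fin 2) (ZMod p)) = !![1, 1; 0, 1] := rfl
  have hT1 : (T : Matrix (Fin 2) (Fin 2) (ZMod p)) ≠ 1 := by
    intro h
    have h01 := congrFun (congrFun h 0) 1
    simp [hTval] at h01
  have hT2 : ((T : Matrix (Fin 2) (Fin 2) (ZMod p)) - 1) * ((T : Matrix (Fin 2) (Fin 2) (ZMod p)) - 1) = 0 := by
    rw [hTval]
    ext i j
    fin_cases i <;> fin_cases j <;> simp [Matrix.mul_apply, Fin.sum_univ_two]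
  -- `v ↦ T v` as an additive automorphism of `𝔽_p²`
  let τ : (Fin 2 → ZMod p) ≃+ (Fin 2 → ZMod p) :=
    { toFun := fun v ↦ (T : Matrix (Fin 2) (Fin 2) (ZMod p)) *ᵥ v
      invFun := fun v ↦ ((T⁻¹ : GL (Fin 2) (ZMod p)) : Matrix (Fin 2) (Fin 2) (ZMod p)) *ᵥ v
      left_inv := fun v ↦ by
        simp only [Matrix.mulVec_mulVec, ← Units.val_mul, inv_mul_cancel, Units.val_one, Matrix.one_mulVec]
      right_inv := fun v ↦ by
        simp only [Matrix.mulVec_mulVec, ← Units.val_mul, mul_inv_cancel, Units.val_one, Matrix.one_mulVec]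
      map_add' := fun v w ↦ Matrix.mulVec_add _ v w }
  have hτ : ∀ v, τ v = (T : Matrix (Fin 2) (Fin 2) (ZMod p)) *ᵥ v := fun _ ↦ rfl
  -- the corresponding automorphism of `E[p]`, realised by some `σ ∈ Γ_ℚ` (surjectivity)
  let φ : geomTorsion W (p : ℤ) ≃+ geomTorsion W (p : ℤ) := (e.trans τ).trans e.symm
  obtain ⟨σ, hσ⟩ := hsurj (Multiplicative.ofAdd φ)
  have hσ' : ∀ P : geomTorsion W (p : ℤ), σ • P = φ P := fun P ↦ by
    have h := congrArg (fun f ↦ (Multiplicative.toAdd f) P) hσ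
    simpa only [galoisRepTorsion_apply, toAdd_ofAdd] using h
  have hρσ : ((ρ σ : GL (Fin 2) (ZMod p)) : Matrix (Fin 2) (Fin 2) (ZMod p)) =
      (T : Matrix (Fin 2) (Fin 2) (ZMod p)) := by
    refine Matrix.toLin'.injective (LinearMap.ext fun w ↦ ?_)
    simp only [Matrix.toLin'_apply]
    obtain ⟨P, rfl⟩ := e.surjective w
    rw [← he σ P, hσ' P]
    change e ((e.trans τ |>.trans e.symm) P) = _
    rw [AddEquiv.trans_apply, AddEquiv.trans_apply, AddEquiv.apply_symm_apply, hτ]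
  exact ⟨σ, by rw [hρσ]; exact hT1, by rw [hρσ]; exact hT2⟩

/-- **(sur) over `ℚ`, `p ≠ 2` ⟹ `ρ̄|_{Γ_K}` absolutely irreducible for a framing over `ℚ` and any
quadratic `K`.** -/
theorem isAbsolutelyIrreducible_comp_of_surj (hp2 : p ≠ 2) (hsurj : W.HasSurjectiveModNGaloisRep (p : ℤ))
    {ρ : ModPGaloisRep ℚ (ZMod p) 2} (hρ : W.IsTorsionGaloisRep p ρ)
    (K : Type) [Field K] [NumberField K] (hK : Module.finrank ℚ K = 2) :
    FramedRep.IsAbsolutelyIrreducible (ρ.comp (absGaloisRestrict ℚ K)) := by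
  have hp : p.Prime := Fact.out
  haveI : NeZero ((p : ℕ) : ℚ) := ⟨by exact_mod_cast hp.ne_zero⟩
  have hirr : FramedRep.IsIrreducible ρ :=
    Literature.NumberTheory.Automorphic.BCDT.isIrreducible_of_hasIrreducibleModPGaloisRep
      (hasIrreducibleModPGaloisRep_of_hasSurjectiveModNGaloisRep W p hsurj) hρ
  obtain ⟨σ, hne, hsq⟩ := exists_transvection_of_surj W p hsurj hρ
  have h2 : (2 : ZMod p) ≠ 0 := by
    change ((2 : ℕ) : ZMod p) ≠ 0
    rw [Ne, ZMod.natCast_eq_zero_iff]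
    intro h
    exact hp2 ((Nat.prime_dvd_prime_iff_eq hp Nat.prime_two).mp h)
  have hindex : (absGaloisRestrict ℚ K).toMonoidHom.range.index = 2 := by
    have h := (Literature.NumberTheory.Automorphic.isOpen_range_absGaloisRestrict_and_index ℚ K).2
    rw [hK] at h
    exact h
  exact Summit.BirchSwinnertonDyer.Rank1Residual.X11b.Transvection.isAbsolutelyIrreducible_comp_of_index_two_of_transvection
    ρ hirr h2 σ hne hsq (absGaloisRestrict ℚ K) hindex

omit [W.IsElliptic] in
/-- **The restriction to `Γ_K` of a framing of `E[p]` over `ℚ` is a framing of `E_K[p]`** (transport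
along the equivariant `E(ℚ̄) ≃ E_K(K̄)`, `exists_addEquiv_geomPoints_baseChange`). -/
theorem isTorsionGaloisRep_baseChange_comp {ρ : ModPGaloisRep ℚ (ZMod p) 2} (hρ : W.IsTorsionGaloisRep p ρ)
    (K : Type) [Field K] [NumberField K] :
    (W.baseChange K).IsTorsionGaloisRep p (ρ.comp (absGaloisRestrict ℚ K)) := by
  have hp : p.Prime := Fact.out
  obtain ⟨e, he⟩ := hρ
  obtain ⟨e₀, he₀⟩ := W.exists_addEquiv_geomPoints_baseChange K
  -- restriction of `e₀` to `p`-torsion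
  have hmem : ∀ T : geomTorsion W (p : ℤ), e₀ T ∈ geomTorsion (W.baseChange K) (p : ℤ) := by
    intro T
    rw [AddSubgroup.torsionBy.nsmul_iff, ← map_nsmul, AddSubgroup.torsionBy.nsmul_iff.mp T.2, map_zero]
  let ψ₀ : geomTorsion W (p : ℤ) →+ geomTorsion (W.baseChange K) (p : ℤ) :=
    AddMonoidHom.codRestrict ((e₀ : W.geomPoints →+ (W.baseChange K).geomPoints).comp
      (geomTorsion W (p : ℤ)).subtype) (geomTorsion (W.baseChange K) (p : ℤ)) hmem
  have hψ₀ : ∀ T, ((ψ₀ T : geomTorsion (W.baseChange K) (p : ℤ)) : (W.baseChange K).geomPoints) = e₀ T :=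
    fun T ↦ rfl
  have hψ₀inj : Function.Injective ψ₀ := by
    intro T T' h
    have h' := congrArg (fun x : geomTorsion (W.baseChange K) (p : ℤ) ↦ (x : (W.baseChange K).geomPoints)) h
    simp only [hψ₀] at h'
    exact Subtype.ext (e₀.injective h')
  have hψ₀surj : Function.Surjective ψ₀ := by
    intro S
    have hS : e₀.symm S ∈ geomTorsion W (p : ℤ) := by
      rw [AddSubgroup.torsionBy.nsmul_iff]
      apply e₀.injective
      rw [map_nsmul, AddEquiv.apply_symm_apply, map_zero]
      exact AddSubgroup.torsionBy.nsmul_iff.mp S.2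
    refine ⟨⟨e₀.symm S, hS⟩, Subtype.ext ?_⟩
    rw [hψ₀]
    exact e₀.apply_symm_apply S
  let ψ : geomTorsion W (p : ℤ) ≃+ geomTorsion (W.baseChange K) (p : ℤ) :=
    AddEquiv.ofBijective ψ₀ ⟨hψ₀inj, hψ₀surj⟩
  have hψ : ∀ (γ : absoluteGaloisGroup K) (T : geomTorsion W (p : ℤ)),
      ψ (absGaloisRestrict ℚ K γ • T) = γ • ψ T := fun γ T ↦
    Subtype.ext (by
      change ((ψ₀ _ : geomTorsion (W.baseChange K) (p : ℤ)) : (W.baseChange K).geomPoints) =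
        ((γ • ψ₀ T : geomTorsion (W.baseChange K) (p : ℤ)) : (W.baseChange K).geomPoints)
      rw [AddSubgroup.torsionBy.coe_smul, hψ₀, hψ₀, AddSubgroup.torsionBy.coe_smul]
      exact he₀ γ T)
  refine ⟨ψ.symm.trans e, fun γ Q ↦ ?_⟩
  obtain ⟨T, rfl⟩ := ψ.surjective Q
  rw [AddEquiv.trans_apply, AddEquiv.trans_apply, ← hψ, AddEquiv.symm_apply_apply,
    AddEquiv.symm_apply_apply]
  exact he _ T

/-- **(sur) ⟹ (irr_K), framed.** For `E/ℚ` with `ρ̄_{E,p}` surjective, `p ≠ 2`, and `K/ℚ`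
quadratic, EVERY `𝔽_p`-framing of `E[p]|_{Γ_K}` is absolutely irreducible (BSTW's (irr_L) /
Yan–Zhu's (irr_K) in the binder's spelling). -/
theorem irrK_framed_of_surj (hp2 : p ≠ 2) (hsurj : W.HasSurjectiveModNGaloisRep (p : ℤ))
    (K : Type) [Field K] [NumberField K] (hK : Module.finrank ℚ K = 2)
    (ρ : ModPGaloisRep K (ZMod p) 2) (hρ : (W.baseChange K).IsTorsionGaloisRep p ρ) :
    FramedRep.IsAbsolutelyIrreducible ρ := by
  have hp : p.Prime := Fact.out
  haveI : NeZero ((p : ℕ) : ℚ) := ⟨by exact_mod_cast hp.ne_zero⟩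
  obtain ⟨ρ₀, hρ₀⟩ := W.exists_isTorsionGaloisRep p
  have habs := isAbsolutelyIrreducible_comp_of_surj W p hp2 hsurj hρ₀ K hK
  have hρ₁ := isTorsionGaloisRep_baseChange_comp W p hρ₀ K
  obtain ⟨P, hP⟩ := hρ₁.exists_conj hρ
  rw [FramedRep.isAbsolutelyIrreducible_iff_coe] at habs ⊢
  exact IsAbsIrreducible.of_conj _ _ P (fun γ ↦ hP γ) habs

end IrrK

/-! ## §6 Assembly: the registered stub `stub_frameData` -/

/-- An integer cast of a natural prime `≡ 1 (mod 4)` is ramified in `ℚ(√ℓ)` (in the sense of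
`RamifiedInQuadratic`) only at `ℓ` itself. -/
theorem eq_of_ramifiedInQuadratic {ℓ q : ℕ} (hℓ : ℓ.Prime) (hℓ4 : ℓ ≡ 1 [MOD 4]) (hq : q.Prime)
    (h : BurungaleSkinnerTianWan2024.RamifiedInQuadratic (ℓ : ℤ) q) : q = ℓ := by
  rcases h with h | ⟨-, h⟩
  · exact (Nat.prime_dvd_prime_iff_eq hq hℓ).mp (Int.natCast_dvd_natCast.mp h)
  · exfalso
    apply h
    have : ((ℓ : ℤ) % 4) = ((ℓ % 4 : ℕ) : ℤ) := by norm_cast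
    rw [this, show ℓ % 4 = 1 from hℓ4]
    norm_num

/-- **`stub_frameData` of line `birth` (crux K1, stmt-BirchSwinnertonDyer-20249), VERBATIM the registered
signature (skeleton 4a5cf194).** For every globally minimal `W/ℚ`, prime `p ≥ 5` with `ClassX7 W p` and
`Surj W p`, granted modularity with parametrisation: the arithmetic frame of K1 exists — an imaginary
quadratic `K` (prime discriminant) with `p = v v̄` split, `v` induced by `ι : ℚ̄_p ≃ ℂ`, `(N, d_K) = 1`,
(irr_K) for every framing, the (cyclotomic, anticyclotomic) tower with an adapted generator pair, the
newform `f` of `W` at level `N = N_W`, an admissible twist `d` (a prime `≡ 1 (mod 4)`, `∤ pN d_K`), a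
globally minimal model `W'` of `W^{(d)}` with `C • W' = W^{(d)}` and its newform `f'` at level `N_{W'}`.
The hypothesis `ClassX7 W p` is carried, not used. -/
theorem stub_frameData : Literature.NumberTheory.EllipticCurves.ModularForms.nonempty_modularParametrizationData → ∀ (W : WeierstrassCurve ℚ) [W.IsElliptic] [W.IsGloballyMinimal] (p : ℕ) [Fact p.Prime], 5 ≤ p → Literature.NumberTheory.EllipticCurves.Rank1Residual.ClassX7 W p → Literature.NumberTheory.EllipticCurves.Rank1Residual.Surj W p → ∃ (K : Type) (_ : Field K) (_ : NumberField K) (ι : PadicAlgCl p ≃+* ℂ) (v vbar : IsDedekindDomain.HeightOneSpectrum (NumberField.RingOfIntegers K)) (κ₁ κ₂ : Literature.NumberTheory.EllipticCurves.ZpExtension K p) (γ₁ γ₂ : Field.absoluteGaloisGroup K) (_ : Fact (Literature.NumberTheory.EllipticCurves.ZpExtension.IsTopGeneratorPair κ₁ κ₂ γ₁ γ₂)) (_ : NeZero (NumberField.discr K).natAbs) (N : ℕ) (_ : NeZero N) (f : CuspForm (CongruenceSubgroup.Gamma0 N) 2) (d : ℤ) (W' : WeierstrassCurve ℚ) (_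 : W'.IsElliptic) (_ : W'.IsGloballyMinimal) (C : WeierstrassCurve.VariableChange ℚ) (N' : ℕ) (_ : NeZero N') (f' : CuspForm (CongruenceSubgroup.Gamma0 N') 2), Literature.NumberTheory.EllipticCurves.ModularForms.IsNewformOf W f ∧ (N : ℤ) = W.conductorNorm ℤ ∧ Literature.NumberTheory.EllipticCurves.ModularForms.IsNewformOf W' f' ∧ (N' : ℤ) = W'.conductorNorm ℤ ∧ Squarefree d ∧ 1 < d ∧ (∀ q : ℕ, q.Prime → Literature.NumberTheory.EllipticCurves.BurungaleSkinnerTianWan2024.RamifiedInQuadratic d q → q ≠ p ∧ ¬ q ∣ N ∧ ¬ (q : ℤ) ∣ NumberField.discr K) ∧ C • W' = W.quadraticTwist (d : ℚ) ∧ Literature.NumberTheory.EllipticCurves.IsImaginaryQuadratic K ∧ ((Ideal.span {(p : ℤ)}).primesOver (NumberField.RingOfIntegers K)).ncard = 2 ∧ ((p : ℕ) : NumberField.RingOfIntegers K) ∈ v.asIdeal ∧ ((p : ℕ) : NumberField.RingOfIntegers K) ∈ vbar.asIdeal ∧ vbar ≠ v ∧ (∀ (w : NumberField.InfinitePlace K)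 (k : NumberField.RingOfIntegers K), k ∈ v.asIdeal ↔ ‖ι.symm (w.embedding (k : K))‖ < 1) ∧ IsCoprime (N : ℤ) (NumberField.discr K) ∧ (∀ ρ : Literature.NumberTheory.GaloisRepresentations.ModPGaloisRep K (ZMod p) 2, (W.baseChange K).IsTorsionGaloisRep p ρ → Literature.NumberTheory.GaloisRepresentations.FramedRep.IsAbsolutelyIrreducible ρ) ∧ κ₁.IsCyclotomic ∧ κ₂.IsAnticyclotomic := by
  intro hmodP W _ _ p _ hp _hX hs
  have hpP : p.Prime := Fact.out
  have hp2 : p ≠ 2 := by omega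
  -- the newform of `W`
  haveI hN0 : NeZero (W.conductorNorm ℤ) := ⟨(WeierstrassCurve.conductorNorm_pos_holds W).ne'⟩
  obtain ⟨D⟩ := hmodP W
  set N : ℕ := W.conductorNorm ℤ with hNdef
  -- §1 the field
  obtain ⟨K, _, _, q, hK, hq, hnq, hdisc, hsplit⟩ := exists_field p (N + p)
  -- §2 the primes above `p`, §4 the embedding datum, §3 the tower
  obtain ⟨v, vbar, hv, hvbar, hne⟩ := exists_pair_of_ncard_primesOver_eq_two hpP hsplit
  obtain ⟨ι, hι⟩ := exists_iota hK v hv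
  obtain ⟨κ₁, κ₂, γ₁, γ₂, hpair, hcyc, hanti⟩ :=
    exists_isTopGeneratorPair_isCyclotomic_isAnticyclotomic (p := p) hK hp2
  haveI : Fact (ZpExtension.IsTopGeneratorPair κ₁ κ₂ γ₁ γ₂) := ⟨hpair⟩
  haveI : NeZero (NumberField.discr K).natAbs :=
    ⟨by rw [hdisc, Int.natAbs_neg, Int.natAbs_natCast]; exact hq.ne_zero⟩
  -- the twist `d = ℓ`, a prime `≡ 1 (mod 4)` beyond `N + p + q`
  obtain ⟨ℓ, hℓ, hℓgt, hℓ4⟩ := Nat.exists_prime_gt_modEq_one (N + p + q) (by norm_num : (4 : ℕ) ≠ 0)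
  have hℓ0 : ((ℓ : ℤ) : ℚ) ≠ 0 := by exact_mod_cast hℓ.ne_zero
  haveI := W.isElliptic_quadraticTwist hℓ0
  obtain ⟨C₀, hC₀⟩ := WeierstrassCurve.hasGlobalMinimalModel_rat_holds (W.quadraticTwist ((ℓ : ℤ) : ℚ))
  haveI : (C₀ • W.quadraticTwist ((ℓ : ℤ) : ℚ)).IsGloballyMinimal := hC₀
  haveI hN0' : NeZero ((C₀ • W.quadraticTwist ((ℓ : ℤ) : ℚ)).conductorNorm ℤ) :=
    ⟨(WeierstrassCurve.conductorNorm_pos_holds _).ne'⟩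
  obtain ⟨D'⟩ := hmodP (C₀ • W.quadraticTwist ((ℓ : ℤ) : ℚ))
  refine ⟨K, inferInstance, inferInstance, ι, v, vbar, κ₁, κ₂, γ₁, γ₂, inferInstance, inferInstance, N,
    inferInstance, D.f, (ℓ : ℤ), C₀ • W.quadraticTwist ((ℓ : ℤ) : ℚ), inferInstance, hC₀, C₀⁻¹,
    (C₀ • W.quadraticTwist ((ℓ : ℤ) : ℚ)).conductorNorm ℤ, inferInstance, D'.f, D.isNewformOf, rfl,
    D'.isNewformOf, rfl, ?_, ?_, ?_, inv_smul_smul C₀ _, hK, hsplit, hv, hvbar, hne, hι, ?_, ?_, hcyc, hanti⟩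
  · -- `ℓ` square-free
    exact Int.squarefree_natCast.mpr hℓ.squarefree
  · -- `1 < ℓ`
    exact_mod_cast hℓ.one_lt
  · -- ramified in `ℚ(√ℓ)` only at `ℓ`, and `ℓ ∤ p N d_K`
    intro q' hq' hram
    obtain rfl := eq_of_ramifiedInQuadratic hℓ hℓ4 hq' hram
    refine ⟨by omega, fun h ↦ ?_, fun h ↦ ?_⟩
    · exact absurd (Nat.le_of_dvd (Nat.pos_of_ne_zero hN0.out) h) (by omega)
    · rw [hdisc, Int.dvd_neg, Int.natCast_dvd_natCast, Nat.prime_dvd_prime_iff_eq hq' hq] at h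
      omega
  · -- `(N, d_K) = 1`
    rw [hdisc]
    exact isCoprime_of_lt hq hN0.out (by omega)
  · -- (irr_K), framed
    exact fun ρ hρ ↦ irrK_framed_of_surj W p hp2 hs K hK.1 ρ hρ

end Summit.BirchSwinnertonDyer.BirchSwinnertonDyer.Theorems.SignedBaseChangeK1FrameData

end
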